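import Summits.BirchSwinnertonDyer.BirchSwinnertonDyer.Theses.TwoAdicConverse
import HarnessLib

/-!
# Route `TwoAdicConverse` (rung S3, cell `bsd-2adic`): the join `Assembly`

The route's bookkeeping item
`Summit.BirchSwinnertonDyer.BirchSwinnertonDyer.Theses.TwoAdicConverse.Assembly :=
  GoodOrdinaryRankZeroTwoConverse → MultiplicativeRankZeroTwoConverse → RankOneTwoConverse →
    Summit.BirchSwinnertonDyer.BirchSwinnertonDyer.Rank1Residual.NonCMTwoConverse`
is pure logic over the definitions: the leaf quantifies over `r ≤ 1`, i.e. `r = 0 ∨ r = 1`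
(`Nat.le_one_iff_eq_zero_or_eq_one`); at `r = 0` the leaf's reduction hypothesis
`GoodOrd W 2 ∨ Mult W 2` splits into the two rank-`0` cruxes, and `r = 1` is the residual crux
`RankOneTwoConverse` verbatim. Nothing is asserted: the three cruxes stay hypotheses of `Assembly`
itself. This is the planner's birth certificate `bc/Assembly_proof.lean` (cell HOME
`plan/routes/TwoAdicConverse/`) re-targeted at the landed rung leaf `NonCMTwoConverse`.
[cite: arXiv250317619, Thm. 1.1 (the 2-converse is its input; shape only)]
-/

set_option autoImplicit false

namespace Summit.BirchSwinnertonDyer.BirchSwinnertonDyer.Theorems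

open Summit.BirchSwinnertonDyer.BirchSwinnertonDyer.Theses.TwoAdicConverse

/-- **The join of route `TwoAdicConverse` holds**: the two rank-`0` `2`-converses (good ordinary `2`,
multiplicative `2`) and the rank-`1` `2`-converse imply the rung-S3 leaf `NonCMTwoConverse`, by cases
on `r ≤ 1` (`r = 0 ∨ r = 1`) and, at `r = 0`, on the reduction type at `2` (`GoodOrd ∨ Mult`). Pure
logic; no fact is consumed. [cite: arXiv250317619, Thm. 1.1 (shape only)] -/
theorem twoAdicConverse_assembly_proof :
    Summit.BirchSwinnertonDyer.BirchSwinnertonDyer.Theses.TwoAdicConverse.Assembly := by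
  unfold Summit.BirchSwinnertonDyer.BirchSwinnertonDyer.Theses.TwoAdicConverse.Assembly
  intro h0o h0m h1 W _ _ hcm hred r hr hsel
  rcases Nat.le_one_iff_eq_zero_or_eq_one.mp hr with rfl | rfl
  · rcases hred with hgo | hmu
    · exact h0o W hcm hgo hsel
    · exact h0m W hcm hmu hsel
  · exact h1 W hcm hred hsel

end Summit.BirchSwinnertonDyer.BirchSwinnertonDyer.Theorems
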